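import Summits.BirchSwinnertonDyer.BirchSwinnertonDyer.Theses.TangentCone
import Summits.BirchSwinnertonDyer.BirchSwinnertonDyer.Theorems.EdgeCap.Negative.FibreStrassmann
import Literature.NumberTheory.EllipticCurves.PeriodRationality

/-!
# `TangentCone.EdgeCap` (stmt-BirchSwinnertonDyer-17609), line `ratio_measure_strassmann`:
# the registered stub `stub_ratioInterpolant` is false as typed, modulo central vanishing
# (negative-side support; this file does NOT refute the crux)

The line file `Cruxes/EdgeCap/Lines/ratio_measure_strassmann.lean` (v4, sha `db39b1a9…`) reduces the
crux to ONE stub A = `stub_ratioInterpolant`: for admissible `(W, p)` and a coprime slope pair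
`a/b < 1/2`, an integral `F ∈ ℚ_p⟦X, Y⟧` with (i) no vertical zero, (ii) the norm-form RATIO
interpolation `‖ι(Λ(g,s)/Λ(g,j))‖ · ‖F(x_k, y_j)‖ = ‖F(x_k, y_s)‖` for every branch member `(k, g, ι, s)`
and EVERY odd `j ≡ 1 (mod p−1)` with `3 ≤ j ≤ k − 2`, (iii) the value-form order bound along the arc.

The typed range of (ii) contains the CENTRAL critical point `j₀ = k/2 = 1 + b(p−1)m`
(`central_index_admissible`). When `Λ(g, k/2) = 0` — which happens for EVERY member of the progression as
soon as the root number of `E` is `−1` (the sign of `g_k` is constant on `k ≡ 2 (mod 2(p−1))`; Howard,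
Math. Ann. 339 (2007); Nekovář–Plater, Asian J. Math. 4 (2000)) — Lean's `x / 0 = 0` turns the ratio into
`0 ∈ K_g` and (ii) into `0 = ‖F(x_k, y_s)‖` (`eval_eq_zero_of_ratio_identity_of_ref_zero`). Feeding this
back into (ii) at the honest reference points LEFT of the centre (where `Λ(g,s)/Λ(g,j) ∈ K_g` is the tree
theorem `IsNewform0.criticalValues_petersson_mem_coeffField` and `≠ 0` is classical non-vanishing of
non-central critical values) kills `F(x_k, y_j)` on the whole progression; Strassmann in the weight
variable (`fibre_eq_zero_of_zeros`, applied to the transposed series) and then in the cyclotomic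
variable kills the fibre at `x = 0`, contradicting (i).

Main statement: `stub_ratioInterpolant_false_of_centralVanishing` — for any admissible `(W, p)`, IF the
`ω⁰`-progression `k = 2 + 2(p−1)m` carries branch members `g_k` (tree fact
`hida_exists_congruent_ordinary_newform`) with `Λ(g_k, k/2) = 0` and non-zero `K_g`-rational edge ratios
`Λ(g_k,1)/Λ(g_k,j)`, `3 ≤ j < k/2` (all four are theorems in print for every `E` of root number `−1`,
e.g. `37a1` at `p = 5`), THEN the verbatim statement of stub A is false. The repair of the line is to
restrict (ii) to `2j + 2 ≤ k`; see the evidence note `stub_ratioInterpolant.md` on the item.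

The `p`-adic analysis (fibre expansion, fibre series in `Λ`, Strassmann via the tree theorem
`MemIwasawaRat.finite_setOf_hasSum_zero`, transposition) is in `FibreStrassmann.lean` (same directory).
-/

noncomputable section

-- D-0017: single-problem summit, so `Summit.BirchSwinnertonDyer.BirchSwinnertonDyer.…` repeats a
-- namespace BY DESIGN.
set_option linter.dupNamespace false

namespace Summit.BirchSwinnertonDyer.BirchSwinnertonDyer.Theorems.EdgeCap.Negative

open Literature.NumberTheory.EllipticCurves Literature.NumberTheory.EllipticCurves.ModularForms
open Summit.BirchSwinnertonDyer.BirchSwinnertonDyer.Theses.TangentCone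

/-! ## §3 The central index and the junk-division collapse of (ii) -/

section Central

/-- `j₀ = k/2` is an admissible reference index of stub A(ii): for `p` odd, `3 ≤ p`, `0 < b` and
`k = 2 + 2 b (p−1) m` with `1 ≤ m`, the number `j₀ = 1 + b (p−1) m` is odd, `≥ 3`, `≡ 1 (mod p−1)`,
`j₀ + 2 ≤ k` and `2 j₀ = k`. [folklore] -/
theorem central_index_admissible (p b m : ℕ) (hp : Odd p) (hp3 : 3 ≤ p) (hb : 0 < b) (hm : 1 ≤ m) :
    Odd (1 + b * (p - 1) * m) ∧ 3 ≤ 1 + b * (p - 1) * m ∧ (p - 1) ∣ (1 + b * (p - 1) * m - 1) ∧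
      ((1 + b * (p - 1) * m : ℕ) : ℤ) + 2 ≤ 2 + 2 * b * ((p : ℤ) - 1) * m ∧
      2 * ((1 + b * (p - 1) * m : ℕ) : ℤ) = 2 + 2 * b * ((p : ℤ) - 1) * m := by
  obtain ⟨q, rfl⟩ := hp
  have hq1 : 1 ≤ q := by omega
  have hsub : 2 * q + 1 - 1 = 2 * q := by omega
  have hcast : (((2 * q + 1 : ℕ) : ℤ) - 1) = 2 * q := by push_cast; ring
  refine ⟨?_, ?_, ?_, ?_, ?_⟩
  · refine ⟨b * q * m, ?_⟩
    rw [hsub]; ring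
  · rw [hsub]
    have h2 : 2 ≤ b * (2 * q) * m := by
      calc 2 = 1 * (2 * 1) * 1 := by norm_num
        _ ≤ b * (2 * q) * m := by gcongr; omega
    omega
  · exact ⟨b * m, by rw [Nat.add_sub_cancel_left]; ring⟩
  · rw [hcast]; push_cast [hsub]
    have h1 : (1 : ℤ) ≤ (b : ℤ) * q * m := by
      have hb' : (1 : ℤ) ≤ b := by exact_mod_cast hb
      have hq' : (1 : ℤ) ≤ q := by exact_mod_cast hq1
      have hm' : (1 : ℤ) ≤ m := by exact_mod_cast hm
      calc (1 : ℤ) = 1 * 1 * 1 := by norm_num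
        _ ≤ b * q * m := by gcongr
    nlinarith [h1]
  · rw [hcast]; push_cast [hsub]; ring

variable {p : ℕ} [Fact p.Prime]

/-- **The junk-division collapse.** If the reference value `Λ(g,j) = ∫₀^∞ t^{j−1} g(it) dt`
vanishes, the norm-form ratio identity of stub A(ii) at that `j` forces `F(x, y_s) = 0`
(`R = Λ(g,s)/0 = 0 ∈ K_g`, `ι 0 = 0`). [folklore] -/
theorem eval_eq_zero_of_ratio_identity_of_ref_zero
    (N : ℕ) (k : ℤ) (g : CuspForm (CongruenceSubgroup.Gamma0 N) k)
    (ι : coeffField g →+* PadicAlgCl p) (F : MvPowerSeries (Fin 2) ℚ_[p]) (s j : ℕ) (x : ℚ_[p])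
    (hii : ∀ hR : (∫ t in Set.Ioi (0 : ℝ), ((t : ℂ) ^ (s - 1)) *
          g (UpperHalfPlane.ofComplex ((t : ℂ) * Complex.I))) /
        (∫ t in Set.Ioi (0 : ℝ), ((t : ℂ) ^ (j - 1)) *
          g (UpperHalfPlane.ofComplex ((t : ℂ) * Complex.I))) ∈ coeffField g,
        ‖ι ⟨_, hR⟩‖ * ‖padicEval₂ F x ((1 + (p : ℚ_[p])) ^ (j - 1) - 1)‖ =
          ‖padicEval₂ F x ((1 + (p : ℚ_[p])) ^ (s - 1) - 1)‖)
    (href : (∫ t in Set.Ioi (0 : ℝ), ((t : ℂ) ^ (j - 1)) *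
          g (UpperHalfPlane.ofComplex ((t : ℂ) * Complex.I))) = 0) :
    padicEval₂ F x ((1 + (p : ℚ_[p])) ^ (s - 1) - 1) = 0 := by
  have hR : (∫ t in Set.Ioi (0 : ℝ), ((t : ℂ) ^ (s - 1)) *
          g (UpperHalfPlane.ofComplex ((t : ℂ) * Complex.I))) /
        (∫ t in Set.Ioi (0 : ℝ), ((t : ℂ) ^ (j - 1)) *
          g (UpperHalfPlane.ofComplex ((t : ℂ) * Complex.I))) ∈ coeffField g := by
    rw [href, div_zero]; exact zero_mem _
  have h := hii hR
  have h0 : (⟨_, hR⟩ : coeffField g) = 0 := by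
    ext
    simp [href]
  rw [h0, map_zero, norm_zero, zero_mul] at h
  exact norm_eq_zero.mp h.symm

/-- **The off-centre consequence.** If, at a reference index `j` whose ratio `R_j` is a NON-ZERO element
of `K_g`, the right-hand side `‖F(x, y_s)‖` of (ii) vanishes, then `F(x, y_j) = 0` (`ι` is injective on
the field `K_g`). [folklore] -/
theorem refEval_eq_zero_of_ratio_identity_of_rhs_zero
    (N : ℕ) (k : ℤ) (g : CuspForm (CongruenceSubgroup.Gamma0 N) k)
    (ι : coeffField g →+* PadicAlgCl p) (F : MvPowerSeries (Fin 2) ℚ_[p]) (s j : ℕ) (x : ℚ_[p])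
    (hii : ∀ hR : (∫ t in Set.Ioi (0 : ℝ), ((t : ℂ) ^ (s - 1)) *
          g (UpperHalfPlane.ofComplex ((t : ℂ) * Complex.I))) /
        (∫ t in Set.Ioi (0 : ℝ), ((t : ℂ) ^ (j - 1)) *
          g (UpperHalfPlane.ofComplex ((t : ℂ) * Complex.I))) ∈ coeffField g,
        ‖ι ⟨_, hR⟩‖ * ‖padicEval₂ F x ((1 + (p : ℚ_[p])) ^ (j - 1) - 1)‖ =
          ‖padicEval₂ F x ((1 + (p : ℚ_[p])) ^ (s - 1) - 1)‖)
    (hR : (∫ t in Set.Ioi (0 : ℝ), ((t : ℂ) ^ (s - 1)) *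
          g (UpperHalfPlane.ofComplex ((t : ℂ) * Complex.I))) /
        (∫ t in Set.Ioi (0 : ℝ), ((t : ℂ) ^ (j - 1)) *
          g (UpperHalfPlane.ofComplex ((t : ℂ) * Complex.I))) ∈ coeffField g)
    (hR0 : (∫ t in Set.Ioi (0 : ℝ), ((t : ℂ) ^ (s - 1)) *
          g (UpperHalfPlane.ofComplex ((t : ℂ) * Complex.I))) /
        (∫ t in Set.Ioi (0 : ℝ), ((t : ℂ) ^ (j - 1)) *
          g (UpperHalfPlane.ofComplex ((t : ℂ) * Complex.I))) ≠ 0)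
    (hrhs : padicEval₂ F x ((1 + (p : ℚ_[p])) ^ (s - 1) - 1) = 0) :
    padicEval₂ F x ((1 + (p : ℚ_[p])) ^ (j - 1) - 1) = 0 := by
  have h := hii hR
  rw [hrhs, norm_zero] at h
  rcases mul_eq_zero.mp h with h1 | h1
  · exfalso
    apply hR0
    have h2 : ι ⟨_, hR⟩ = 0 := norm_eq_zero.mp h1
    have h3 : (⟨_, hR⟩ : coeffField g) = 0 := ι.injective (by rw [h2, map_zero])
    exact congrArg Subtype.val h3
  · exact norm_eq_zero.mp h1

end Central

/-! ## §4 The stub is false modulo central vanishing along the `ω⁰`-progression -/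

/-- **`stub_ratioInterpolant` is false as typed, modulo central vanishing.** Let `(W, p)` be admissible
exactly as in `EdgeCap` / stub A. Suppose that for every `m ≥ 1`, at the weight `k = 2 + 2(p−1)m` of the
`ω⁰`-progression of slope `a/b = 0/1` (so `s = 1`), there is a branch member `(g, ι)` in the sense of
A(ii) — a `p`-ordinary newform of level `N_E` congruent to `E` away from `N_E p` (Hida; tree fact
`hida_exists_congruent_ordinary_newform`) — whose CENTRAL completed value vanishes,
`Λ(g, k/2) = completedLValue g (k/2) = 0` (root number `−1`: constant sign on the progression, Howard 2007,
Nekovář–Plater 2000), and whose edge ratios `Λ(g,1)/Λ(g,j)`, `j` odd, `j ≡ 1 (mod p−1)`, `3 ≤ j < k/2`,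
are NON-ZERO elements of `K_g` (Shimura 1977 = tree theorem
`IsNewform0.criticalValues_petersson_mem_coeffField`; non-vanishing of non-central critical values).
Then the verbatim statement of `stub_ratioInterpolant` (line `ratio_measure_strassmann`, v4) is false:
(ii) at the central index `j₀ = k/2` (admissible: `central_index_admissible`) collapses by `x/0 = 0` to
`F(x_k, 0) = 0`; (ii) at the honest indices then gives `F(x_k, y_j) = 0` on the whole progression;
Strassmann in `x` (`weightFibre_eq_zero_of_zeros`) gives `F(·, y_j) ≡ 0` for infinitely many `j`, and
Strassmann in `y` (`fibre_eq_zero_of_zeros`) kills the fibre at `x = 0`, contradicting (i). All four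
hypotheses hold in print for every `E/ℚ` of root number `−1` at every admissible `p` (e.g. `37a1`,
`p = 5`), so the stub must be repaired (restrict (ii) to `2j + 2 ≤ k`). [folklore] -/
theorem stub_ratioInterpolant_false_of_centralVanishing
    (W : WeierstrassCurve ℚ) [W.IsElliptic] [W.IsGloballyMinimal] (hN : NeZero (W.conductorNorm ℤ))
    (p : ℕ) [Fact p.Prime] (h5 : 5 ≤ p) (hgood : W.HasGoodReductionAtPrime p)
    (hord : ¬ (p : ℤ) ∣ W.frobeniusTrace p) (hna : ¬ (p : ℤ) ∣ (W.frobeniusTrace p) ^ 2 - 1)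
    (hsurj : W.HasSurjectiveModNGaloisRep p)
    (hBr : ∀ (M : ℕ) (_ : NeZero M) (g : CuspForm (CongruenceSubgroup.Gamma0 M) 2)
      (ι : coeffField g →+* PadicAlgCl p), M ∣ W.conductorNorm ℤ * p → IsNewform0 g →
      ‖ι ⟨(UpperHalfPlane.qExpansion 1 ⇑g).coeff p, coeff_mem_coeffField g p⟩‖ = 1 →
      (∀ ℓ : ℕ, ℓ.Prime → ¬ ℓ ∣ W.conductorNorm ℤ * p →
        ‖ι ⟨(UpperHalfPlane.qExpansion 1 ⇑g).coeff ℓ, coeff_mem_coeffField g ℓ⟩ -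
          ((W.frobeniusTrace ℓ : ℤ) : PadicAlgCl p)‖ < 1) →
      M = W.conductorNorm ℤ ∧ ∀ n : ℕ, (UpperHalfPlane.qExpansion 1 ⇑g).coeff n = ((W.LFunction n : ℤ) : ℂ))
    (hmem : ∀ (k : ℤ) (m j₀ : ℕ), 1 ≤ m → k = 2 + 2 * ((p : ℤ) - 1) * m → 2 * (j₀ : ℤ) = k →
      ∃ (g : CuspForm (CongruenceSubgroup.Gamma0 (W.conductorNorm ℤ)) k)
        (ι : coeffField g →+* PadicAlgCl p),
        IsNewform0 g ∧
        ‖ι ⟨(UpperHalfPlane.qExpansion 1 ⇑g).coeff p, coeff_mem_coeffField g p⟩‖ = 1 ∧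
        (∀ ℓ : ℕ, ℓ.Prime → ¬ ℓ ∣ W.conductorNorm ℤ * p →
          ‖ι ⟨(UpperHalfPlane.qExpansion 1 ⇑g).coeff ℓ, coeff_mem_coeffField g ℓ⟩ -
            ((W.frobeniusTrace ℓ : ℤ) : PadicAlgCl p)‖ < 1) ∧
        completedLValue g j₀ = 0 ∧
        ∀ j : ℕ, Odd j → 3 ≤ j → (p - 1) ∣ (j - 1) → 2 * (j : ℤ) + 2 ≤ k →
          completedLValue g 1 / completedLValue g j ∈ coeffField g ∧
          completedLValue g 1 / completedLValue g j ≠ 0) :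
    ¬ (
      ∀ (W : WeierstrassCurve ℚ) [W.IsElliptic] [W.IsGloballyMinimal] (_ : NeZero (W.conductorNorm ℤ)) (p : ℕ)
        [Fact p.Prime], 5 ≤ p → W.HasGoodReductionAtPrime p → ¬ (p : ℤ) ∣ W.frobeniusTrace p → ¬ (p : ℤ) ∣
        (W.frobeniusTrace p) ^ 2 - 1 → W.HasSurjectiveModNGaloisRep p → (∀ (M : ℕ) (_ : NeZero M) (g :
        CuspForm (CongruenceSubgroup.Gamma0 M) 2) (ι :
        Literature.NumberTheory.EllipticCurves.ModularForms.coeffField g →+* PadicAlgCl p), M ∣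
        W.conductorNorm ℤ * p → Literature.NumberTheory.EllipticCurves.ModularForms.IsNewform0 g → ‖ι
        ⟨(UpperHalfPlane.qExpansion 1 ⇑g).coeff p,
        Literature.NumberTheory.EllipticCurves.ModularForms.coeff_mem_coeffField g p⟩‖ = 1 → (∀ ℓ : ℕ, ℓ.Prime
        → ¬ ℓ ∣ W.conductorNorm ℤ * p → ‖ι ⟨(UpperHalfPlane.qExpansion 1 ⇑g).coeff ℓ,
        Literature.NumberTheory.EllipticCurves.ModularForms.coeff_mem_coeffField g ℓ⟩ - ((W.frobeniusTrace ℓ :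
        ℤ) : PadicAlgCl p)‖ < 1) → M = W.conductorNorm ℤ ∧ ∀ n : ℕ, (UpperHalfPlane.qExpansion 1 ⇑g).coeff n =
        ((W.LFunction n : ℤ) : ℂ)) → ∀ (a b : ℕ), 0 < b → 2 * a < b → a.Coprime b → ∃ F : MvPowerSeries (Fin
        2) ℚ_[p], Literature.NumberTheory.EllipticCurves.IsPadicInt F ∧ (∀ x : ℚ_[p], ‖x‖ < 1 → ∃ y : ℚ_[p],
        ‖y‖ < 1 ∧ Literature.NumberTheory.EllipticCurves.padicEval₂ F x y ≠ 0) ∧ (∀ (k : ℤ) (g : CuspForm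
        (CongruenceSubgroup.Gamma0 (W.conductorNorm ℤ)) k) (ι :
        Literature.NumberTheory.EllipticCurves.ModularForms.coeffField g →+* PadicAlgCl p) (s : ℕ), (2 * b *
        (p - 1) : ℤ) ∣ (k - 2) → (b : ℤ) * ((s : ℤ) - 1) = a * (k - 2) →
        Literature.NumberTheory.EllipticCurves.ModularForms.IsNewform0 g → ‖ι ⟨(UpperHalfPlane.qExpansion 1
        ⇑g).coeff p, Literature.NumberTheory.EllipticCurves.ModularForms.coeff_mem_coeffField g p⟩‖ = 1 → (∀ ℓ
        : ℕ, ℓ.Prime → ¬ ℓ ∣ W.conductorNorm ℤ * p → ‖ι ⟨(UpperHalfPlane.qExpansion 1 ⇑g).coeff ℓ,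
        Literature.NumberTheory.EllipticCurves.ModularForms.coeff_mem_coeffField g ℓ⟩ - ((W.frobeniusTrace ℓ :
        ℤ) : PadicAlgCl p)‖ < 1) → ∀ j : ℕ, Odd j → 3 ≤ j → (p - 1) ∣ (j - 1) → (j : ℤ) + 2 ≤ k → ∀ hR : (∫ t
        in Set.Ioi (0 : ℝ), ((t : ℂ) ^ (s - 1)) * g (UpperHalfPlane.ofComplex ((t : ℂ) * Complex.I))) / (∫ t
        in Set.Ioi (0 : ℝ), ((t : ℂ) ^ (j - 1)) * g (UpperHalfPlane.ofComplex ((t : ℂ) * Complex.I))) ∈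
        Literature.NumberTheory.EllipticCurves.ModularForms.coeffField g, ‖ι ⟨_, hR⟩‖ *
        ‖Literature.NumberTheory.EllipticCurves.padicEval₂ F ((1 + (p : ℚ_[p])) ^ (k - 2) - 1) ((1 + (p :
        ℚ_[p])) ^ (j - 1) - 1)‖ = ‖Literature.NumberTheory.EllipticCurves.padicEval₂ F ((1 + (p : ℚ_[p])) ^ (k
        - 2) - 1) ((1 + (p : ℚ_[p])) ^ (s - 1) - 1)‖) ∧ (∀ t : ℕ,
        ‖Literature.NumberTheory.EllipticCurves.padicEval₂ F ((1 + (p : ℚ_[p])) ^ (b * t) - 1) ((1 + (p :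
        ℚ_[p])) ^ (a * t) - 1)‖ ≤ ‖(t : ℚ_[p])‖ ^ W.selmerCorank p)) := by
  intro hA
  have hp := (Fact.out : p.Prime)
  have hp2 : p ≠ 2 := by omega
  have hpodd : Odd p := hp.odd_of_ne_two hp2
  have hp1 : 1 ≤ p := hp.one_lt.le
  -- A at slope `0/1`
  obtain ⟨F, hFi, hvert, hinterp, -⟩ :=
    hA W hN p h5 hgood hord hna hsurj hBr 0 1 one_pos (by norm_num) (Nat.coprime_one_right 0)
  -- notation for the progression
  have hcastp : ((p - 1 : ℕ) : ℤ) = (p : ℤ) - 1 := by push_cast [Nat.cast_sub hp1]; ring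
  -- Step A: on the whole progression, `F(x_k, 0) = 0` and `F(x_k, y_j) = 0` left of the centre
  have stepA : ∀ m : ℕ, 1 ≤ m →
      padicEval₂ F ((1 + (p : ℚ_[p])) ^ (2 * (p - 1) * m) - 1) 0 = 0 ∧
      ∀ j : ℕ, Odd j → 3 ≤ j → (p - 1) ∣ (j - 1) → 2 * (j : ℤ) + 2 ≤ 2 + 2 * ((p : ℤ) - 1) * m →
        padicEval₂ F ((1 + (p : ℚ_[p])) ^ (2 * (p - 1) * m) - 1)
          ((1 + (p : ℚ_[p])) ^ (j - 1) - 1) = 0 := by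
    intro m hm
    set k : ℤ := 2 + 2 * ((p : ℤ) - 1) * m with hk
    obtain ⟨hodd₀, h3₀, hdvd₀, hle₀, hcen₀⟩ := central_index_admissible p 1 m hpodd (by omega) one_pos hm
    have hk1 : (2 + 2 * (1 : ℕ) * ((p : ℤ) - 1) * m : ℤ) = k := by rw [hk]; push_cast; ring
    rw [hk1] at hle₀ hcen₀
    obtain ⟨g, ι, hnew, hordg, hcong, hcentral, hoff⟩ := hmem k m (1 + 1 * (p - 1) * m) hm rfl hcen₀
    -- hypotheses of (ii) at `(k, g, ι, s = 1)`
    have hdiv : (2 * ((1 : ℕ) : ℤ) * ((p : ℤ) - 1)) ∣ (k - 2) := ⟨m, by rw [hk]; push_cast; ring⟩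
    have hs : (((1 : ℕ) : ℤ)) * ((((1 : ℕ) : ℤ)) - 1) = ((0 : ℕ) : ℤ) * (k - 2) := by push_cast; ring
    have hii := hinterp k g ι 1 hdiv hs hnew hordg hcong
    -- the point `x_k` in power form
    have hxk : (1 + (p : ℚ_[p])) ^ (k - 2) - 1 = (1 + (p : ℚ_[p])) ^ (2 * (p - 1) * m) - 1 := by
      have : k - 2 = ((2 * (p - 1) * m : ℕ) : ℤ) := by rw [hk]; push_cast [Nat.cast_sub hp1]; ring
      rw [this, zpow_natCast]
    have hy1 : (1 + (p : ℚ_[p])) ^ (1 - 1) - 1 = 0 := by simp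
    -- central collapse
    have hc := eval_eq_zero_of_ratio_identity_of_ref_zero (W.conductorNorm ℤ) k g ι F 1
      (1 + 1 * (p - 1) * m) ((1 + (p : ℚ_[p])) ^ (k - 2) - 1)
      (hii (1 + 1 * (p - 1) * m) hodd₀ h3₀ hdvd₀ hle₀) hcentral
    rw [hy1] at hc
    refine ⟨by rw [← hxk]; exact hc, fun j hjodd hj3 hjdvd hjk => ?_⟩
    obtain ⟨hRj, hRj0⟩ := hoff j hjodd hj3 hjdvd hjk
    have hjk' : (j : ℤ) + 2 ≤ k := by omega
    have h := refEval_eq_zero_of_ratio_identity_of_rhs_zero (W.conductorNorm ℤ) k g ι F 1 j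
      ((1 + (p : ℚ_[p])) ^ (k - 2) - 1) (hii j hjodd hj3 hjdvd hjk') hRj hRj0 (by rw [hy1]; exact hc)
    rw [← hxk]; exact h
  -- Step B: for every reference index `j`, `F(x, y_j) = 0` for ALL `x` in the disc
  have stepB : ∀ j : ℕ, Odd j → 3 ≤ j → (p - 1) ∣ (j - 1) →
      ∀ x : ℚ_[p], ‖x‖ < 1 → padicEval₂ F x ((1 + (p : ℚ_[p])) ^ (j - 1) - 1) = 0 := by
    intro j hjodd hj3 hjdvd
    refine weightFibre_eq_zero_of_zeros F hFi (norm_one_add_pow_sub_one_lt p _)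
      (z := fun n : ℕ => (1 + (p : ℚ_[p])) ^ (2 * (p - 1) * (j + n)) - 1) ?_
      (fun n => norm_one_add_pow_sub_one_lt p _) ?_
    · intro a b hab
      have h1 := one_add_pow_sub_one_injective p hab
      have h2 : 2 * (p - 1) * (j + a) = 2 * (p - 1) * (j + b) := h1
      have hp0 : 0 < 2 * (p - 1) := by omega
      have h3 := Nat.eq_of_mul_eq_mul_left hp0 h2
      omega
    · intro n
      have hm : 1 ≤ j + n := by omega
      refine (stepA (j + n) hm).2 j hjodd hj3 hjdvd ?_
      push_cast
      have hj0 : (0 : ℤ) ≤ j := by positivity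
      have hn0 : (0 : ℤ) ≤ n := by positivity
      have hp4 : (4 : ℤ) ≤ (p : ℤ) - 1 := by omega
      nlinarith [hj0, hn0, hp4]
  -- Step C: the fibre at `x = 0` vanishes along the injective family `y_{j_n}`, `j_n = 2(p−1)(n+1)+1`
  have hzero : ∀ y : ℚ_[p], ‖y‖ < 1 → padicEval₂ F 0 y = 0 := by
    refine fibre_eq_zero_of_zeros F hFi (by simp)
      (z := fun n : ℕ => (1 + (p : ℚ_[p])) ^ (2 * ((p - 1) * (n + 1)) + 1 - 1) - 1) ?_
      (fun n => norm_one_add_pow_sub_one_lt p _) ?_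
    · intro a b hab
      have h1 := one_add_pow_sub_one_injective p hab
      have h2 : 2 * ((p - 1) * (a + 1)) + 1 - 1 = 2 * ((p - 1) * (b + 1)) + 1 - 1 := h1
      have hp0 : 0 < p - 1 := by omega
      have h3 : (p - 1) * (a + 1) = (p - 1) * (b + 1) := by omega
      have h4 := Nat.eq_of_mul_eq_mul_left hp0 h3
      omega
    · intro n
      refine stepB (2 * ((p - 1) * (n + 1)) + 1) ⟨(p - 1) * (n + 1), by ring⟩ ?_ ?_ 0 (by simp)
      · have : 1 ≤ (p - 1) * (n + 1) := Nat.one_le_iff_ne_zero.mpr (Nat.mul_ne_zero (by omega) (by omega))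
        omega
      · exact ⟨2 * (n + 1), by rw [Nat.add_sub_cancel]; ring⟩
  -- contradiction with (i) at `x = 0`
  obtain ⟨y, hy, hne⟩ := hvert 0 (by simp)
  exact hne (hzero y hy)

end Summit.BirchSwinnertonDyer.BirchSwinnertonDyer.Theorems.EdgeCap.Negative
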